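import Summits.CriticalPhenomena.SAWScalingLimit.Theorems.FKGToTraversalBound.Negative.DeepEndpointGap
import Summits.CriticalPhenomena.SAWScalingLimit.Theorems.TPToTraversalBound.Negative.TPToTraversalBoundDeepStart
import Literature.Probability.LatticeModels.CellDomainBoundary

/-!
# Negative knowledge on crux `FKGToTraversalBound` (stmt-CriticalPhenomena-1878), part 2:
the repair R1 typed, a certified member of the deep-endpoint fragment, and top/bottom bookkeeping

Refuter `cdisprove` (standing adversary, cycle 2); work file
`Summits/CriticalPhenomena/SAWScalingLimit/Cruxes/FKGToTraversalBound/Disproof.lean` §8–§9.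

* `SAWTraversalBoundBdry` — (H1) restricted to endpoint approximations that are eventually LATTICE-BOUNDARY
  vertices (`meshBoundary`), the only ones whose time-zero carrier is admissible for `LeftRightFKG`
  (part 1, `DeepEndpointGap`: both-deep carriers kill the PA clause weight-free; the first-step device presents
  no r2 domain); `FKGToTraversalBoundBdry := LeftRightFKG → SAWTraversalBoundBdry` is what the route's
  PA/RSW engine can at best deliver; `DeepEndpointReduction := SAWTraversalBoundBdry → SAWTraversalBound` is the
  missing item; `crux_iff_split`: crux ⟺ R1-crux ∧ (PA → reduction).
* `exists_isEndpointApprox_not_bdryApprox` — the R1 class provably OMITS an admissible endpoint approximation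
  of the unit disc (the sibling's depth-`√δ` start, `TPToTraversalBound.Negative.exists_isEndpointApprox_deepStart`,
  is never a lattice-boundary vertex: `not_mem_meshBoundary_of_ball_subset`), so the reduction has content.
* `maximal_unique_of_top` — with a top element the two-maximal kill of part 1 (`not_PAClause_of_two_maximal`)
  cannot fire; by the structure theorem F5 of the work file (admissible carriers have a top and a bottom:
  loop-erased outer facial walk, argmax-region argument) `LeftRightFKG` can only be refuted through the weights.

No named fact is used; axioms are the standard three.
-/

namespace Summit.CriticalPhenomena.SAWScalingLimit.Theorems.FKGToTraversalBound.Negative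

open Summit.CriticalPhenomena.SAWScalingLimit.Theses.SAWLeftRightFKG
open Literature.Probability.RandomPlanarGeometry Literature.Probability.LatticeModels MeasureTheory
open Filter Topology Set

/-! ## Top / bottom bookkeeping (F5) -/

/-- `t` is a top of the chord poset for the crux's order `lrLE`. [folklore] -/
def IsTop {Ω : Set ℂ} {δ : ℝ} {a b : Site 2} (t : SAW.DomainSAW Ω δ a b) : Prop := ∀ γ, lrLE γ t

/-- `s` is a bottom of the chord poset. [folklore] -/
def IsBot {Ω : Set ℂ} {δ : ℝ} {a b : Site 2} (s : SAW.DomainSAW Ω δ a b) : Prop := ∀ γ, lrLE s γ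

/-- A maximal element below a top is the top. [folklore] -/
theorem eq_of_isTop_of_maximal {Ω : Set ℂ} {δ : ℝ} {a b : Site 2} {t m : SAW.DomainSAW Ω δ a b}
    (ht : IsTop t) (hm : ∀ γ, lrLE m γ → γ = m) : t = m :=
  hm t (ht m)

/-- With a top, `≼`-maximal chords are unique: on admissible carriers (work-file F5) the weight-free
two-maximal kill `not_PAClause_of_two_maximal` is unavailable. [folklore] -/
theorem maximal_unique_of_top {Ω : Set ℂ} {δ : ℝ} {a b : Site 2} {t m₁ m₂ : SAW.DomainSAW Ω δ a b}
    (ht : IsTop t) (h₁ : ∀ γ, lrLE m₁ γ → γ = m₁) (h₂ : ∀ γ, lrLE m₂ γ → γ = m₂) : m₁ = m₂ :=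
  (eq_of_isTop_of_maximal ht h₁).symm.trans (eq_of_isTop_of_maximal ht h₂)

/-- Dually for minimal chords above a bottom. [folklore] -/
theorem minimal_unique_of_bot {Ω : Set ℂ} {δ : ℝ} {a b : Site 2} {s m₁ m₂ : SAW.DomainSAW Ω δ a b}
    (hs : IsBot s) (h₁ : ∀ γ, lrLE γ m₁ → γ = m₁) (h₂ : ∀ γ, lrLE γ m₂ → γ = m₂) : m₁ = m₂ :=
  (h₁ s (hs m₁)).symm.trans (h₂ s (hs m₂))

/-! ## The repair R1 typed -/

/-- (H1) for ONE endpoint approximation — verbatim the body of `SAWTraversalBound`. [folklore] -/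
def H1At (D : DobrushinDomain) (a b : ℝ → Site 2) : Prop :=
  ∃ (k : ℂ → ℝ → ℝ → ℕ) (K lam δ₀ : ℝ), 0 ≤ K ∧ 2 < lam ∧ 0 < δ₀ ∧ ∀ δ ∈ Set.Ioc (0 : ℝ) δ₀,
    ∀ (x : ℂ) (ρ R : ℝ), δ ≤ ρ → ρ < R → R ≤ 1 →
      SAW.law D.carrier δ (a δ) (b δ)
        {γ | (⟨γ.walk.toCurve (meshPoint δ)⟩ : Curve ℂ).HasTraversals (k x ρ R) x ρ R} ≤
        ENNReal.ofReal (K * (ρ / R) ^ lam)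

/-- (H1) is `H1At` for every endpoint approximation (definitional). [folklore] -/
theorem traversalBound_iff_H1At :
    SAWTraversalBound ↔ ∀ (D : DobrushinDomain) (a b : ℝ → Site 2), SAW.IsEndpointApprox D a b → H1At D a b :=
  Iff.rfl

/-- The R1 class: both lattice endpoints are eventually vertices of the lattice boundary of `Ω_δ`. [folklore] -/
def BdryApprox (D : DobrushinDomain) (a b : ℝ → Site 2) : Prop :=
  ∀ᶠ δ in 𝓝[>] (0 : ℝ), a δ ∈ meshBoundary D.carrier δ ∧ b δ ∈ meshBoundary D.carrier δ

/-- STATEMENT VARIANT (not a literature fact): (H1) restricted to the R1 class. -/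
def SAWTraversalBoundBdry : Prop :=
  ∀ (D : DobrushinDomain) (a b : ℝ → Site 2), SAW.IsEndpointApprox D a b → BdryApprox D a b → H1At D a b

/-- STATEMENT VARIANT (not a literature fact): the crux restricted to the R1 class — what a PA/RSW engine can at best deliver. -/
def FKGToTraversalBoundBdry : Prop := LeftRightFKG → SAWTraversalBoundBdry

/-- STATEMENT VARIANT (not a literature fact; an OPEN reduction, candidate route item): boundary-endpoint (H1) ⇒ (H1) for all endpoint approximations. -/
def DeepEndpointReduction : Prop := SAWTraversalBoundBdry → SAWTraversalBound

/-- (H1) implies its R1 restriction. [folklore] -/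
theorem traversalBoundBdry_of_traversalBound (h : SAWTraversalBound) : SAWTraversalBoundBdry :=
  fun D a b hab _ => h D a b hab

/-- The crux implies its R1 restriction. [folklore] -/
theorem bdryCrux_of_crux (h : FKGToTraversalBound) : FKGToTraversalBoundBdry :=
  fun hl => traversalBoundBdry_of_traversalBound (h hl)

/-- **The split is exact**: crux ⟺ R1-crux ∧ (PA → reduction). [folklore] -/
theorem crux_iff_split :
    FKGToTraversalBound ↔ FKGToTraversalBoundBdry ∧ (LeftRightFKG → DeepEndpointReduction) :=
  ⟨fun h => ⟨bdryCrux_of_crux h, fun hl _ => h hl⟩, fun h hl => h.2 hl (h.1 hl)⟩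

/-! ## A certified member of the deep-endpoint fragment -/

/-- `meshDomain` is a union of components: it is closed under mesh-adjacency. [folklore] -/
theorem mem_meshDomain_of_adj {Ω : Set ℂ} {δ : ℝ} {x y : Site 2} (hx : x ∈ meshDomain Ω δ)
    (hy : y ∈ meshVertices Ω δ) (hxy : (meshGraph Ω δ).Adj x y) : y ∈ meshDomain Ω δ := by
  simp only [meshDomain, Set.mem_iUnion, Set.mem_image] at hx ⊢
  obtain ⟨K, hK, x', hx'K, hx'x⟩ := hx
  refine ⟨K, hK, ⟨y, hy⟩, ?_, rfl⟩
  rw [SimpleGraph.ConnectedComponent.mem_supp_iff] at hx'K ⊢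
  rw [← hx'K]
  have hadj : (meshVertexGraph Ω δ).Adj ⟨y, hy⟩ x' := by
    simp only [SimpleGraph.comap_adj, Function.Embedding.coe_subtype, hx'x]
    exact hxy.symm
  exact SimpleGraph.ConnectedComponent.sound hadj.reachable

/-- A site whose `√δ`-ball lies inside `Ω` is NOT a lattice-boundary vertex (`0 < δ < 1`): all four
neighbours are mesh vertices joined to it by edges inside `Ω̄`, hence in the same component. [folklore] -/
theorem not_mem_meshBoundary_of_ball_subset {Ω : Set ℂ} {δ : ℝ} (hδ : 0 < δ) (hδ1 : δ < 1) {x : Site 2}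
    (hball : Metric.ball (meshPoint δ x) (Real.sqrt δ) ⊆ Ω) : x ∉ meshBoundary Ω δ := by
  intro hx
  rw [mem_meshBoundary_iff] at hx
  obtain ⟨hxD, y, hxy, hnadj⟩ := hx
  apply hnadj
  have hδs : δ < Real.sqrt δ := by
    rw [Real.lt_sqrt hδ.le]
    nlinarith
  have hyball : meshPoint δ y ∈ Metric.ball (meshPoint δ x) (Real.sqrt δ) := by
    rw [Metric.mem_ball, dist_eq_norm]
    calc ‖meshPoint δ y - meshPoint δ x‖
        ≤ |(meshPoint δ y - meshPoint δ x).re| + |(meshPoint δ y - meshPoint δ x).im| :=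
          Complex.norm_le_abs_re_add_abs_im _
      _ = δ := (abs_re_im_meshPoint_sub_of_adj hδ.le hxy).2.2
      _ < Real.sqrt δ := hδs
  have hxball : meshPoint δ x ∈ Metric.ball (meshPoint δ x) (Real.sqrt δ) :=
    Metric.mem_ball_self (Real.sqrt_pos.2 hδ)
  have hseg : segment ℝ (meshPoint δ x) (meshPoint δ y) ⊆ closure Ω :=
    ((convex_ball _ _).segment_subset hxball hyball).trans (hball.trans subset_closure)
  have hmadj : (meshGraph Ω δ).Adj x y := meshGraph_adj_iff.2 ⟨hxy, hseg⟩
  have hyV : y ∈ meshVertices Ω δ := hball hyball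
  exact discreteDomainGraph_adj_iff.2 ⟨hmadj, hxD, mem_meshDomain_of_adj hxD hyV hmadj⟩

section DeepFragment
open Summit.CriticalPhenomena.SAWScalingLimit.Theorems.TPToTraversalBound

/-- **The R1 class omits an admissible endpoint approximation** (certified): the sibling's depth-`√δ`
approximation of the unit disc is an `IsEndpointApprox` whose start is, for every `δ ≤ 1/16`, not a
lattice-boundary vertex.  Hence `SAWTraversalBoundBdry` quantifies over strictly fewer approximations than
`SAWTraversalBound`, and `DeepEndpointReduction` is a genuine item. [folklore] -/
theorem exists_isEndpointApprox_not_bdryApprox :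
    ∃ a b : ℝ → Site 2, SAW.IsEndpointApprox DobrushinDomain.unitDisc a b ∧
      ¬ BdryApprox DobrushinDomain.unitDisc a b := by
  obtain ⟨a, b, hab, hdeep⟩ := Negative.exists_isEndpointApprox_deepStart
  refine ⟨a, b, hab, fun hbd => ?_⟩
  have hsmall : Set.Ioc (0 : ℝ) (1 / 16) ∈ 𝓝[>] (0 : ℝ) := Ioc_mem_nhdsGT (by norm_num)
  obtain ⟨δ, ⟨hmb, -⟩, hδ0, hδ1⟩ := (hbd.and hsmall).exists
  exact not_mem_meshBoundary_of_ball_subset hδ0 (by linarith) (hdeep δ hδ0 hδ1) hmb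

/-- Consequently the R1 side condition is not implied by `IsEndpointApprox`. [folklore] -/
theorem exists_approx_outside_R1 :
    ¬ ∀ (D : DobrushinDomain) (a b : ℝ → Site 2), SAW.IsEndpointApprox D a b → BdryApprox D a b := by
  intro h
  obtain ⟨a, b, hab, hnot⟩ := exists_isEndpointApprox_not_bdryApprox
  exact hnot (h _ a b hab)

end DeepFragment

end Summit.CriticalPhenomena.SAWScalingLimit.Theorems.FKGToTraversalBound.Negative
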